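import Mathlib.Combinatorics.SimpleGraph.Walk.Operations
import Mathlib.Combinatorics.SimpleGraph.Connectivity.Connected
import HarnessLib

/-!
# Decomposition of a connection at a separating set: inside edges, the separator, outside edges (proved)

Topic `Literature/Combinatorics/SimpleGraph`. Companion of `SeparatingSetsOrder.lean`. Let `H` be a
graph, `O ≤ H` a subgraph ("the open edges"), `In`, `Out` vertex sets and `P` a vertex set SEPARATING
them in `H` (every `H`-walk from `In` to `Out` meets `P`; typically the vertex set of an open crosscut
of an annulus). Write

* `Int` = the vertices reachable from `In` by `H`-walks avoiding `P` (the inside of `P`),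
  `Ext` = those reachable from `Out` avoiding `P` (the outside); `Int ∩ Ext = ∅`, `Int ∩ P = ∅`;
* `Oᵢₙ` = the open edges with an endpoint in `Int` (inside edges), `Oₒᵤₜ` = the open edges with no
  endpoint in `Int`.

Then an open connection `x ↔ y` from `x ∈ In` to `y ∈ Out` DECOMPOSES: `x` is joined to a vertex of
`P` by inside open edges (`exists_mem_reachable_inside`: the piece before the FIRST visit to `P`), and
a vertex of `P` is joined to `y` by outside open edges (`exists_mem_reachable_outside`: the piece after
the LAST visit), and conversely such pieces together with an outside-open connection of the two
vertices of `P` give `x ↔ y` (`reachable_of_inside_of_outside`). This is the event algebra of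
Kesten's decomposition of the arm event at the outermost open circuit (H. Kesten, PTRF 73 (1986),
proof of Thm. 3: `{0 ↔ ∂B(n)} ∩ {Γ = γ} = {0 ↔ γ inside γ} ∩ {γ ↔ ∂B(n) outside γ} ∩ {Γ = γ}`),
written without planarity: the sets `Int`, `Ext` and the graphs `Oᵢₙ`, `Oₒᵤₜ` enter through
characterising hypotheses, so the file introduces no definition. Everything is proved.

## References

* H. Kesten, *The incipient infinite cluster in two-dimensional percolation*, Probab. Theory Related
  Fields 73 (1986) 369–394, proof of Thm. 3.
-/

namespace Literature.Combinatorics.SimpleGraph.SeparatingSets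

open _root_.SimpleGraph

variable {V : Type*} {H O Oin Oout : SimpleGraph V} {In Out P Int Ext : Set V}

/-- `Int ∩ P = ∅`: a vertex reached from `In` avoiding `P` is not in `P`. [cite: Kesten1986, proof of Thm. 3] -/
theorem not_mem_of_mem_inside
    (hInt : ∀ u, u ∈ Int ↔ ∃ i ∈ In, ∃ w : H.Walk i u, ∀ z ∈ w.support, z ∉ P)
    {u : V} (hu : u ∈ Int) : u ∉ P := by
  obtain ⟨i, -, w, hw⟩ := (hInt u).1 hu
  exact hw u w.end_mem_support

/-- `Int ∩ Ext = ∅` when `P` separates: otherwise glue the two avoiding walks into an `In → Out` walk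
avoiding `P`. [cite: Kesten1986, proof of Thm. 3] -/
theorem not_mem_outside_of_mem_inside
    (hsep : ∀ ⦃i⦄, i ∈ In → ∀ ⦃o⦄, o ∈ Out → ∀ w : H.Walk i o, ∃ z ∈ w.support, z ∈ P)
    (hInt : ∀ u, u ∈ Int ↔ ∃ i ∈ In, ∃ w : H.Walk i u, ∀ z ∈ w.support, z ∉ P)
    (hExt : ∀ u, u ∈ Ext ↔ ∃ o ∈ Out, ∃ w : H.Walk o u, ∀ z ∈ w.support, z ∉ P)
    {u : V} (hu : u ∈ Int) : u ∉ Ext := by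
  intro hu'
  obtain ⟨i, hi, w₁, hw₁⟩ := (hInt u).1 hu
  obtain ⟨o, ho, w₂, hw₂⟩ := (hExt u).1 hu'
  obtain ⟨z, hz, hzP⟩ := hsep hi ho (w₁.append w₂.reverse)
  rw [Walk.support_append, List.mem_append] at hz
  rcases hz with hz | hz
  · exact hw₁ z hz hzP
  · have hz' : z ∈ w₂.reverse.support := List.tail_subset _ hz
    rw [Walk.support_reverse, List.mem_reverse] at hz'
    exact hw₂ z hz' hzP

/-- **Before the first visit: inside edges.** If `x ∈ In` is joined to `y ∈ Out` in the open graph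
`O ≤ H` and `P` separates `In` from `Out` in `H`, then `x` is joined to some vertex of `P` in the
graph `Oᵢₙ` of open edges having an endpoint inside `P`. (Induction along the open walk: while it has
not met `P` it stays inside.) [cite: Kesten1986, proof of Thm. 3] -/
theorem exists_mem_reachable_inside (hOH : O ≤ H)
    (hsep : ∀ ⦃i⦄, i ∈ In → ∀ ⦃o⦄, o ∈ Out → ∀ w : H.Walk i o, ∃ z ∈ w.support, z ∈ P)
    (hInt : ∀ u, u ∈ Int ↔ ∃ i ∈ In, ∃ w : H.Walk i u, ∀ z ∈ w.support, z ∉ P)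
    (hOin : ∀ u v, Oin.Adj u v ↔ O.Adj u v ∧ (u ∈ Int ∨ v ∈ Int))
    {x y : V} (hx : x ∈ In) (hy : y ∈ Out) (hxP : x ∉ P) (hxy : O.Reachable x y) :
    ∃ v ∈ P, Oin.Reachable x v := by
  obtain ⟨w⟩ := hxy
  -- along an open walk towards a vertex of `Out`, from a vertex inside
  suffices key : ∀ {u t : V} (_ : O.Walk u t), t ∈ Out → u ∈ Int → ∃ v ∈ P, Oin.Reachable u v from
    key w hy ((hInt x).2 ⟨x, hx, Walk.nil, fun z hz => by
      rw [Walk.support_nil, List.mem_singleton] at hz; subst hz; exact hxP⟩)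
  intro u t q
  induction q with
  | nil =>
    -- `u = t ∈ Out` inside: an `In → Out` walk avoiding `P`
    intro ht hu
    obtain ⟨i, hi, w₁, hw₁⟩ := (hInt _).1 hu
    obtain ⟨z, hz, hzP⟩ := hsep hi ht w₁
    exact absurd hzP (hw₁ z hz)
  | @cons u u₁ z' huu₁ q ih =>
    intro ht hu
    have ih := ih ht
    by_cases hu₁ : u₁ ∈ P
    · exact ⟨u₁, hu₁, Adj.reachable ((hOin u u₁).2 ⟨huu₁, Or.inl hu⟩)⟩
    · have hu₁I : u₁ ∈ Int := by
        obtain ⟨i, hi, w₁, hw₁⟩ := (hInt u).1 hu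
        refine (hInt u₁).2 ⟨i, hi, w₁.append (Walk.cons (hOH huu₁) Walk.nil), fun z hz => ?_⟩
        rw [Walk.support_append, List.mem_append] at hz
        rcases hz with hz | hz
        · exact hw₁ z hz
        · simp only [Walk.support_cons, Walk.support_nil, List.tail_cons, List.mem_singleton] at hz
          subst hz; exact hu₁
      obtain ⟨v, hv, hreach⟩ := ih hu₁I
      exact ⟨v, hv, (Adj.reachable ((hOin u u₁).2 ⟨huu₁, Or.inl hu⟩)).trans hreach⟩

/-- **After the last visit: outside edges.** If `x ∈ In` is joined to `y ∈ Out` in the open graph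
`O ≤ H`, `P` separates `In` from `Out` in `H` and `y ∉ P`, then some vertex of `P` is joined to `y` in
the graph `Oₒᵤₜ` of open edges with no endpoint inside `P` (the piece after the last visit runs in
the outside `Ext`, which is disjoint from the inside). [cite: Kesten1986, proof of Thm. 3] -/
theorem exists_mem_reachable_outside (hOH : O ≤ H)
    (hsep : ∀ ⦃i⦄, i ∈ In → ∀ ⦃o⦄, o ∈ Out → ∀ w : H.Walk i o, ∃ z ∈ w.support, z ∈ P)
    (hInt : ∀ u, u ∈ Int ↔ ∃ i ∈ In, ∃ w : H.Walk i u, ∀ z ∈ w.support, z ∉ P)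
    (hExt : ∀ u, u ∈ Ext ↔ ∃ o ∈ Out, ∃ w : H.Walk o u, ∀ z ∈ w.support, z ∉ P)
    (hOout : ∀ u v, Oout.Adj u v ↔ O.Adj u v ∧ u ∉ Int ∧ v ∉ Int)
    {x y : V} (hx : x ∈ In) (hy : y ∈ Out) (hyP : y ∉ P) (hxy : O.Reachable x y) :
    ∃ w ∈ P, Oout.Reachable w y := by
  obtain ⟨w⟩ := hxy
  have hPI : ∀ {u : V}, u ∈ P → u ∉ Int := fun hu hu' => not_mem_of_mem_inside hInt hu' hu
  have hEI : ∀ {u : V}, u ∈ Ext → u ∉ Int := fun hu hu' =>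
    not_mem_outside_of_mem_inside hsep hInt hExt hu' hu
  -- along the reversed open walk towards a vertex of `In`, from a vertex outside
  suffices key : ∀ {u t : V} (_ : O.Walk u t), t ∈ In → u ∈ Ext → ∃ v ∈ P, Oout.Reachable u v by
    obtain ⟨v, hv, hreach⟩ := key w.reverse hx ((hExt y).2 ⟨y, hy, Walk.nil, fun z hz => by
      rw [Walk.support_nil, List.mem_singleton] at hz; subst hz; exact hyP⟩)
    exact ⟨v, hv, hreach.symm⟩
  intro u t q
  induction q with
  | nil =>
    intro ht hu
    obtain ⟨o, ho, w₁, hw₁⟩ := (hExt _).1 hu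
    obtain ⟨z, hz, hzP⟩ := hsep ht ho w₁.reverse
    rw [Walk.support_reverse, List.mem_reverse] at hz
    exact absurd hzP (hw₁ z hz)
  | @cons u u₁ z' huu₁ q ih =>
    intro ht hu
    have ih := ih ht
    by_cases hu₁ : u₁ ∈ P
    · exact ⟨u₁, hu₁, Adj.reachable ((hOout u u₁).2 ⟨huu₁, hEI hu, hPI hu₁⟩)⟩
    · have hu₁E : u₁ ∈ Ext := by
        obtain ⟨o, ho, w₁, hw₁⟩ := (hExt u).1 hu
        refine (hExt u₁).2 ⟨o, ho, w₁.append (Walk.cons (hOH huu₁) Walk.nil), fun z hz => ?_⟩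
        rw [Walk.support_append, List.mem_append] at hz
        rcases hz with hz | hz
        · exact hw₁ z hz
        · simp only [Walk.support_cons, Walk.support_nil, List.tail_cons, List.mem_singleton] at hz
          subst hz; exact hu₁
      obtain ⟨v, hv, hreach⟩ := ih hu₁E
      exact ⟨v, hv, (Adj.reachable ((hOout u u₁).2 ⟨huu₁, hEI hu, hEI hu₁E⟩)).trans hreach⟩

/-- **Converse: gluing through the separator wired from outside.** If `x` is joined to `v ∈ P` by
inside open edges, `w ∈ P` is joined to `y` by outside open edges, any two vertices of `P` are joined
by outside open edges, and `Oᵢₙ, Oₒᵤₜ ≤ O`, then `x ↔ y` in `O`. [cite: Kesten1986, proof of Thm. 3] -/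
theorem reachable_of_inside_of_outside (hin : Oin ≤ O) (hout : Oout ≤ O)
    (hP : ∀ v ∈ P, ∀ w ∈ P, Oout.Reachable v w)
    {x y v w : V} (hv : v ∈ P) (hw : w ∈ P)
    (hxv : Oin.Reachable x v) (hwy : Oout.Reachable w y) : O.Reachable x y :=
  (hxv.mono hin).trans (((hP v hv w hw).mono hout).trans (hwy.mono hout))

end Literature.Combinatorics.SimpleGraph.SeparatingSets
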